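import Summits.BirchSwinnertonDyer.Rank1Residual.X11b.Three.TamagawaAtom
import Summits.BirchSwinnertonDyer.Rank1Residual.X11b.BDPRouteOpenInputOdd
import Literature.NumberTheory.EllipticCurves.SemistablePeuRamifieRamifiedPrime
import HarnessLib

/-!
# Class X11b at `p = 3` (team N8/O2 = cell `b2b-bsdres`, sub-target T2P3-ANATOMY, seat x11b3-p3): the
# Tamagawa atom (T2′)@3 DECOMPOSED into (T2α)@3 ∣ (T2β)@3 ∣ (T2γ)@3 = additive Kodaira `IV`/`IV*`
# with `c_ℓ = 3`, and route p2's whole-class `p = 3` record with the Tamagawa binder LOCALISED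

HONEST FRAMING (verbatim, cell `b2b-bsdres`, run/shared/lean/b2b/bsd-rank1-residual/): the goal of
the cell is to DELETE the COMBINATION-SHAPED residual classes for ALL analytic-rank `≤ 1` curves
over `ℚ` — "full BSD formula for every rank `≤ 1` curve in class `C`" assembled STRICTLY from
published theorems — so that the rank-`≤ 1` remainder becomes exactly the CONSTRUCTION-SHAPED
classes, which are TYPED (missing-input Props), NOT attempted; this is not "finishing BSD".
Team N8/O2 works the class X11b at the prime `3` (`ClassX11b W 3`: `ord_{s=1} L(E,s) = 1`, `3 ∥ N`,
`E[3]` irreducible), whose class-level input STEP L at `3` has NO source, not even an announced one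
(RESIDUAL-MAP §I O2, OPEN). Research route; no claim beyond the stated class and sub-populations;
nothing booked; NO label changes (X11 ∧ `r = 1` at `p = 3` stays CONSTRUCTION-SHAPED, R6.2).
THEOREMS ONLY: no definition, no named fact, no `sorry`; every cited input is a published theorem
already in the tree (Tate's algorithm / Kodaira–Néron, discharged place by place) or one of the
twelve published named facts of route p2, consumed as hypotheses exactly as in the sibling files.

## What this file does

Route p2's `p = 3` record (multr1-p2, `P2.bsdp_three_of_onTree`, `BDPRouteOpenInputOdd.lean`)
reads: `∀ E, (E,3) ∈ X11b → BSD(E,3)` ⇐ twelve published facts + THE open input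
`P2OpenInputOnTreeOddAt W 3` + (T2′)@3 + (T4″)@3, where **(T2′)@3** is the Euler-system half
`Typed.MissingUpperBoundAt W 3` on `Surj ∧ ¬(Ram ∧ 3 ∤ ∏c_ℓ)` — class-wide 133 910 of the 383 149
X11b@3 class-pairs `N < 5·10⁵` (multr1-p2 `census3`, two engines), of which 123 739 are the
Tamagawa atom proper `Ram ∧ 3 ∣ ∏c_ℓ` and 10 171 the `¬Ram` atom. At primes `p > 3` the sibling
LOCALISED the Tamagawa atom (`BDPRouteTamagawaSupport.lean`, p212560): by Kodaira–Néron `c_ℓ ≤ 4`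
unless `ℓ` is split multiplicative, so `p ∣ ∏c_ℓ` iff some split multiplicative `ℓ` has
`p ∣ ord_ℓ(Δ_min)` — shapes (T2α) `ℓ = p` and (T2β) `ℓ ≠ p`. **At `p = 3` the bound `c_ℓ ≤ 4`
decides nothing**, and Tate's algorithm (Silverman *ATAEC* IV.9.4, Table 4.1; tree facts
`localTamagawaNumber_of_kodairaSymbolAt_eq_IV_holds`, `…_IVstar_holds`, the `II/III/I₀*/Iₙ*/III*/II*`
rows and the non-split `Iₙ` row, all discharged) says exactly which additive fibres carry a `3`:
types `IV` and `IV*`, with `c ∈ {1, 3}`.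

* Companion `X11b/Three/TamagawaAtom.lean` (§1–§2 there): `split_or_typeIV_of_odd_prime_dvd_localTamagawaNumber`
  (any number field, any place: an ODD prime `p ∣ c_w` ⟹ split multiplicative with
  `p ∣ ord_w(Δ_min)`, OR `p = 3 ∧` type `IV`/`IV*` `∧ c_w = 3`) and **`three_dvd_tamagawaProduct_iff`**
  (`3 ∣ ∏c_ℓ ⟺ (∃ split multiplicative ℓ, 3 ∣ ord_ℓ Δ_min) ∨ (∃ place of type IV/IV* with c = 3)`;
  on SEMISTABLE curves the second disjunct is empty).
* §3 (X11b@3): **`tamagawa_atom_shape_three`** — the Tamagawa atom at `3` has THREE local shapes: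
  (T2α)@3 split at `3` and peu ramifié (`3 ∣ ord_3 Δ_min`) ∣ (T2β)@3 an unramified split
  multiplicative `ℓ ≠ 3` ∣ **(T2γ)@3 an ADDITIVE place of type `IV`/`IV*` with `c = 3`** (over a
  prime `ℓ ≠ 3`, `primesEquiv_ne_three_of_typeIV`; EMPTY on semistable curves,
  `tamagawa_atom_shape_three_of_semistable`). Pair-level records
  `bsdp_three_of_classX11b_of_ram_of_openInput_tamagawaLocal` (X11b@3 ∧ Ram: `BSD(E,3)` ⇐ facts +
  THE open input + the upper-half binder of the ONE local shape that occurs; on `3 ∤ ∏c_ℓ` the upper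
  half is the sibling's theorem `missingUpperBoundAt_of_classX11b_of_ram_of_not_dvd`) and its
  semistable form ((ram) automatic at `3` by `ram_three_of_semistable_of_irr`, rmap-3 g4).
* §4 **`bsdp_three_of_classX11b_of_onTreeInputs_tamagawaLocal`** — the sibling's whole-class `p = 3`
  record with (T2′)@3 SPLIT into the binders (T2α)@3, (T2β)@3, (T2γ)@3 and `¬Ram`; they ask no more
  than (T2′)@3 (`localBinders_of_typedUpperThree`).

## Why (T2γ)@3 is a separate residue (a statement about PRINTED hypotheses, not a claim)

The only printed device for the Euler-system half on a pair with `p ∣ c_ℓ` is Jetchev–Skinner–Wan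
2017 §7.4.2 (arXiv:1512.06894 p. 31, quoted from `paper:arxiv-1512.06894` p0031 L5–L13: "Recall
that `N = q_1⋯q_r` … If `r` is odd, let `N⁺ = q_1` and `N⁻ = N/q_1` … (b) the primes dividing `N⁻`
are all inert in `K″`"), i.e. the offending primes are put into `N⁻` of a Shimura curve
`X_{N⁺,N⁻}` under their hypothesis (H) (p0017 L21–L25: "`N⁻` is squarefree with an even number of
prime factors"); the Tamagawa factors at `N⁻` are then absorbed by the degree comparison
(`∏_{ℓ∣N⁻} c_ℓ`, Ribet–Takahashi / Pasten 2024 §6; multr1-p2 gens 9–11). A (T2β)@3 prime is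
MULTIPLICATIVE and can go into `N⁻`; a (T2γ)@3 prime is ADDITIVE (`ℓ² ∣ N`), cannot (hypothesis
(H)), and when split in `K″` contributes `c_w(E/K″) = c_ℓ(E) = 3` at both places above it
((eq:tamK)) — precisely the situation §7.4.2 is built to avoid ("there are no `w ∣ N⁺` such that
`p ∣ c_w(E/K″)`", p0031 L33). So on (T2γ)@3 no printed or announced road to the upper half exists
even in shape; the binder `hUγ` is typed AS SUCH. (Whether the sibling's large-prime (T2β) road —
`missingUpperBoundAt_of_classX11b_of_ram_of_not_alpha_GZR`, stated for primes `p > 3` — survives at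
`p = 3` on the pure-(T2β)@3 pairs is the next question of this sub-target, not settled here: its
inert-prime Tamagawa cancellation uses `c ≤ 4 < p`, which at `3` must be replaced by the non-split
row `c ∈ {1, 2}`.)

## Census (EVIDENCE, TWO engines — PARI `elllocalred` (kit job j119963) ‖ a pure-Python Tate's
## algorithm (kit job j120492): 383 149 / 383 149 rows identical in all columns; this seat;
## population = multr1-p2's `census3` input `pairs3.txt.gz` sha256 f9aea8d7…; NOT a fact, nothing booked)

`3 ∣ ∏c_ℓ ⟺ (T2α)@3 ∨ (T2β)@3 ∨ (T2γ)@3` holds on 383 149 / 383 149 pairs (0 violations; `3 ∣ ∏c_ℓ`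
on 128 897, = census3). On the Tamagawa atom `Ram ∧ 3 ∣ ∏c_ℓ` (123 739 pairs; semistable 51 241):
(T2α)@3 46 804 · (T2β)@3 66 576 · (T2γ)@3 23 263 (overlaps: α∧γ 2 836, β∧γ∖α 2 466); EXCLUSIVE
shapes α-only 36 606 · β-only 56 508 · **γ-only 17 961** (window `N < 2·10⁴`: 725; `N < 10⁴`: 361);
on semistable pairs γ = 0 (kernel: `not_exists_typeIV_of_semistable`). The (T2γ) places lie over
`ℓ = 2` (14 327 of 24 932 γ-places class-wide), `5` (4 626), `7` (2 691), `11`, `13`, …; smallest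
γ-only pairs `156a1` (`ℓ = 2`, IV, `∏c = 6`), `228b1` (`2`, IV*), `348a1`, `348d1`, `372a1`. Of the
lane's 568 TRUE-OPEN (T2′)@3 cells after R196 (rmap-3 g5 `x11b3_left.tsv`): β-only 76, γ-only 48,
α-only 37, α∧β 229, α∧γ 178; of the seven `#Ш_an = 9` classes lacking an upper half, `318828a1`
(`ℓ = 2`, IV), `368358k1` (`ℓ = 29`, IV*), `498525ca1` (`ℓ = 17`, IV*) are γ-only. Evidence file:
`run/shared/lean/b2b/bsd-rank1-residual/b2b-bsdres-x11b3-p3/T2P3-ANATOMY.md`.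

References: [SilvermanATAEC1994] IV.9.4 Steps 1–10 and Table 4.1 (PDF pp. 344–346), Cor. IV.9.2(d)
(p. 340); [JetchevSkinnerWan2017] §4.1 hypothesis (H) (arXiv p. 17), §7.4.2 (p. 31), Thm. 4.4.1
(p. 19); [Castella2018] Thm. 2.3, Thm. 3.2; [Castella2018Erratum] (2.4); [Skinner2016PacificMC] Thm. C;
[Wuthrich2014] Prop. 21; [Miller2011LMS] Def. 1.1; [Ribet1990] Thm. 1.1; [Diamond1995RefinedSerre].
-/

noncomputable section

open scoped Classical

open WeierstrassCurve NumberField IsDedekindDomain Field Literature.NumberTheory.EllipticCurves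
  Rat.HeightOneSpectrum
  Literature.NumberTheory.DiophantineGeometry
  Literature.NumberTheory.EllipticCurves.GreenbergSelmer
  Literature.NumberTheory.EllipticCurves.ModularForms
  Literature.NumberTheory.EllipticCurves.Rank1Residual
  Literature.NumberTheory.EllipticCurves.Rank1Residual.Typed
  Literature.NumberTheory.EllipticCurves.Wuthrich2014
  Literature.NumberTheory.EllipticCurves.BalakrishnanEtAl2019
  Literature.NumberTheory.QuadraticFields.Quadratic
  Literature.NumberTheory.Automorphic
  Literature.NumberTheory.GaloisRepresentations Literature.NumberTheory.GaloisCohomology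
  Summit.BirchSwinnertonDyer.Rank1Residual.X11b.AcSelmer
  Summit.BirchSwinnertonDyer.Rank1Residual.X11b.LocBridge

namespace Summit.BirchSwinnertonDyer.Rank1Residual.X11b.Three

/-! ### §3 Class X11b at `p = 3`: the (T2′)@3 atom decomposed, and the whole-class record with localised binders -/

section ClassLevel

variable (W : WeierstrassCurve ℚ) [W.IsElliptic] [W.IsGloballyMinimal]

/-- **The Tamagawa atom of X11b@3 has THREE local shapes.** For an X11b pair `(E,3)` with
`3 ∣ ∏_ℓ c_ℓ(E)`: (T2α)@3 `E` is SPLIT multiplicative at `3` and peu ramifié there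
(`3 ∣ ord_3 Δ_min`); or (T2β)@3 a split multiplicative `ℓ ≠ 3` with `3 ∣ ord_ℓ Δ_min` (a multiplicative
prime at which `ρ̄_{E,3}` is UNRAMIFIED); or **(T2γ)@3 an additive place of Kodaira type `IV` or
`IV*` with `c = 3`** — the shape with no analogue at primes `p > 3` (multr1-p2's
`ClassX11b.tamagawa_atom_shape`, stated for primes greater than `3`). Census (kit jobs j119963 ‖
j120492, two engines, this seat; population = multr1-p2's census3, 383 149 class-pairs
`N < 5·10⁵`): see the module docstring.
[cite: SilvermanATAEC1994, IV.9.4 Steps 2, 5, 8 and Table 4.1 (PDF pp. 344–346)] -/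
theorem tamagawa_atom_shape_three [Fact (Nat.Prime 3)] (_hX : ClassX11b W 3)
    (ht : 3 ∣ W.tamagawaProduct) :
    (W.HasSplitMultiplicativeReductionAtPrime 3 ∧ 3 ∣ padicValInt 3 W.minimalDiscriminantInt) ∨
      (∃ ℓ : ℕ, ∃ _ : Fact ℓ.Prime, ℓ ≠ 3 ∧ W.HasSplitMultiplicativeReductionAtPrime ℓ ∧
        3 ∣ padicValInt ℓ W.minimalDiscriminantInt) ∨
      (∃ v : HeightOneSpectrum (𝓞 ℚ),
        (W.kodairaSymbolAt v = .IV ∨ W.kodairaSymbolAt v = .IVstar) ∧ W.tamagawaNumberAt v = 3) := by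
  rcases (three_dvd_tamagawaProduct_iff W).mp ht with ⟨ℓ, hℓ, hs, hd⟩ | hγ
  · by_cases h3 : ℓ = 3
    · subst h3
      exact Or.inl ⟨hs, hd⟩
    · exact Or.inr (Or.inl ⟨ℓ, hℓ, h3, hs, hd⟩)
  · exact Or.inr (Or.inr hγ)

omit [W.IsGloballyMinimal] in
/-- **A (T2γ)@3 place of an X11b@3 pair lies over a prime `ℓ ≠ 3`**: the reduction at the place over
`3` is multiplicative (`3 ∥ N`), hence of type `Iₙ`, never `IV`/`IV*`. [folklore] -/
theorem primesEquiv_ne_three_of_typeIV [Fact (Nat.Prime 3)] (hX : ClassX11b W 3)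
    {v : HeightOneSpectrum (𝓞 ℚ)} (hk : W.kodairaSymbolAt v = .IV ∨ W.kodairaSymbolAt v = .IVstar) :
    (primesEquiv v : ℕ) ≠ 3 := by
  intro h3
  have hmult3 : Mult W 3 := hX.2.2.1
  have key : ∀ (q : ℕ) (hq : Fact q.Prime), q = 3 →
      @WeierstrassCurve.HasMultiplicativeReductionAtPrime W q hq := by
    rintro q hq rfl; exact hmult3
  have hmult : W.HasMultiplicativeReductionAt v :=
    (W.hasMultiplicativeReductionAtPrime_iff_hasMultiplicativeReductionAt_ringOfIntegers v).mp
      (key _ _ h3)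
  exact (not_good_not_mult_of_kodairaSymbolAt_IV W v hk).2 hmult

omit [W.IsGloballyMinimal] in
/-- **A (T2γ)@3 place is an ADDITIVE prime in the cell's vocabulary** (`Addv W ℓ = ¬Good ∧ ¬Mult` at
the prime `ℓ` under the place): the census dictionary "γ ⟹ `E` is not semistable". [folklore] -/
theorem addv_of_typeIV {v : HeightOneSpectrum (𝓞 ℚ)}
    (hk : W.kodairaSymbolAt v = .IV ∨ W.kodairaSymbolAt v = .IVstar) :
    (haveI := Fact.mk (primesEquiv v).2; Addv W (primesEquiv v : ℕ)) := by
  haveI := Fact.mk (primesEquiv v).2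
  obtain ⟨hng, hnm⟩ := not_good_not_mult_of_kodairaSymbolAt_IV W v hk
  exact ⟨fun hg => hng ((hasGoodReductionAtPrime_iff_hasGoodReductionAt_ringOfIntegers v W).mp hg),
    fun hm => hnm
      ((W.hasMultiplicativeReductionAtPrime_iff_hasMultiplicativeReductionAt_ringOfIntegers v).mp hm)⟩

/-- **On a SEMISTABLE X11b@3 pair the Tamagawa atom has only the two large-prime shapes** ((T2γ)@3 is
empty: `not_exists_typeIV_of_semistable`). Census3 split (rmap-3 g4): of the 133 910 (T2′)@3
class-pairs, 51 241 are semistable. [cite: SilvermanATAEC1994, Cor. IV.9.2(d) (PDF p. 340)] -/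
theorem tamagawa_atom_shape_three_of_semistable [Fact (Nat.Prime 3)] (hX : ClassX11b W 3)
    (hsst : Semistable W) (ht : 3 ∣ W.tamagawaProduct) :
    (W.HasSplitMultiplicativeReductionAtPrime 3 ∧ 3 ∣ padicValInt 3 W.minimalDiscriminantInt) ∨
      (∃ ℓ : ℕ, ∃ _ : Fact ℓ.Prime, ℓ ≠ 3 ∧ W.HasSplitMultiplicativeReductionAtPrime ℓ ∧
        3 ∣ padicValInt ℓ W.minimalDiscriminantInt) := by
  rcases tamagawa_atom_shape_three W hX ht with hα | hβ | hγ
  · exact Or.inl hα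
  · exact Or.inr hβ
  · exact absurd hγ (not_exists_typeIV_of_semistable W hsst)

/-- **`BSD(E,3)` on the (ram) part of X11b@3 from THE open input and the three LOCALISED upper-half
binders** (pair level). For `(E,3) ∈` X11b with a (ram) prime: the lower half is route p2's
`P2.missingLowerBoundAt_of_openInputOddAt` (THE open input `P2OpenInputOnTreeOddAt W 3` — NO source
at `p = 3`, not even announced; `ρ̄_{E,3}` is onto by `surj_of_irr_of_ram`); the upper half is a
THEOREM on `3 ∤ ∏c_ℓ` (`missingUpperBoundAt_of_classX11b_of_ram_of_not_dvd`, twelve published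
facts) and otherwise is asked ONLY on the local shape that occurs: (T2α)@3, (T2β)@3 or (T2γ)@3
(`tamagawa_atom_shape_three`). CONDITIONAL on the open input and on the binders actually
triggered; nothing booked; X11 ∧ `r = 1` at `p = 3` stays CONSTRUCTION-SHAPED (O2 OPEN).
[cite: JetchevSkinnerWan2017, §7.4.1–7.4.3 (pp. 30–31)] [cite: Castella2018, Thm. 2.3 (p. 5), Thm. 3.2 (p. 9)]
[cite: Skinner2016PacificMC, Thm. C (§1) and footnote 1] [cite: Wuthrich2014, Prop. 21 (p. 400)]
[cite: McCallumLMS1991, §1 Theorem (Kolyvagin), p. 296] [cite: Miller2011LMS, Def. 1.1]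
[cite: SilvermanATAEC1994, IV.9.4 Steps 2, 5, 8 (PDF pp. 344–346)] -/
theorem bsdp_three_of_classX11b_of_ram_of_openInput_tamagawaLocal [Fact (Nat.Prime 3)]
    -- published inputs (named facts of the tree)
    (hGZ : ∀ (N : ℕ) [NeZero N] (W : WeierstrassCurve ℚ) (K : Type) [Field K] [NumberField K],
      gross_zagier N W K)
    (hKo : ∀ (N : ℕ) [NeZero N] (W : WeierstrassCurve ℚ) (K : Type) [Field K] [NumberField K],
      kolyvagin N W K)
    (hB : ∀ (N : ℕ) [NeZero N] (W : WeierstrassCurve ℚ) (K : Type) [Field K] [NumberField K],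
      Kolyvagin1990_padicValNat_card_sha_le N W K)
    (hSk : Skinner2016.thmC_padicValRat_bsd_rank_zero) (hWu : sha_dvd_analyticSha)
    (hGZK : rank_eq_analyticRank_of_analyticRank_le_one) (hmod : hasEntireLFunction_rat)
    (hnf : exists_isNewformOf) (hHL : HoffsteinLuo1997_exists_twist_L_one_ne_zero)
    (hMaz : mazur_not_dvd_maninConstant_of_odd)
    (hPT : ∀ (K : Type) [Field K] [NumberField K], poitouTate_sum_localTatePairing_eq_zero K)
    (hEP : ∀ (K : Type) [Field K] [NumberField K] (v : HeightOneSpectrum (𝓞 K)),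
      localEulerPoincareCharacteristic (v.adicCompletion K))
    -- the pair: X11b at 3 with a (ram) prime
    (hX : ClassX11b W 3) (hram : Ram W 3)
    -- (T1ᵗ-IMC, odd) THE open input at this pair — no source at `p = 3`
    (hA : P2OpenInputOnTreeOddAt W 3)
    -- (T2α)@3: split at 3, peu ramifié
    (hUα : W.HasSplitMultiplicativeReductionAtPrime 3 → 3 ∣ padicValInt 3 W.minimalDiscriminantInt →
      Typed.MissingUpperBoundAt W 3)
    -- (T2β)@3: an unramified split multiplicative `ℓ ≠ 3`
    (hUβ : ∀ (ℓ : ℕ) [Fact ℓ.Prime], ℓ ≠ 3 → W.HasSplitMultiplicativeReductionAtPrime ℓ →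
      3 ∣ padicValInt ℓ W.minimalDiscriminantInt → Typed.MissingUpperBoundAt W 3)
    -- (T2γ)@3: an additive place of type IV / IV* with `c = 3`
    (hUγ : ∀ v : HeightOneSpectrum (𝓞 ℚ),
      (W.kodairaSymbolAt v = .IV ∨ W.kodairaSymbolAt v = .IVstar) → W.tamagawaNumberAt v = 3 →
        Typed.MissingUpperBoundAt W 3) :
    BSDp W 3 := by
  have hsurj : Surj W 3 := surj_of_irr_of_ram W 3 hX.2.2.2 hram
  refine Typed.bsdp_of_missingPPartAt W 3 hGZK (by rw [hX.1]) ?_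
  refine Typed.missingPPartAt_of_lower_of_upper W 3
    (P2.missingLowerBoundAt_of_openInputOddAt W 3 hGZ hKo hWu hGZK hmod hnf hHL hMaz hPT hEP hA hX
      hsurj) ?_
  by_cases ht : 3 ∣ W.tamagawaProduct
  · rcases tamagawa_atom_shape_three W hX ht with ⟨hs, hd⟩ | ⟨ℓ, hℓ, hne, hs, hd⟩ | ⟨v, hk, hc⟩
    · exact hUα hs hd
    · exact hUβ ℓ hne hs hd
    · exact hUγ v hk hc
  · exact missingUpperBoundAt_of_classX11b_of_ram_of_not_dvd hGZ hKo hB hSk hGZK hmod hnf hHL hMaz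
      integral_neronScaling_of_isGloballyMinimal_holds W 3 hX hram ht

/-- **Semistable X11b@3 pair: `BSD(E,3)` from THE open input + the two large-prime-shaped binders**
((ram) automatic by `ram_three_of_semistable_of_irr` — Ribet + Diamond's refined Serre, `hLL`; no
(T2γ)@3 on a semistable curve). CONDITIONAL; nothing booked.
[cite: Ribet1990, Thm. 1.1] [cite: Diamond1995RefinedSerre, Thm. 1.1]
[cite: SilvermanATAEC1994, IV.9.4 Steps 2, 5, 8 (PDF pp. 344–346)] -/
theorem bsdp_three_of_semistable_classX11b_of_openInput_tamagawaLocal [Fact (Nat.Prime 3)]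
    (hGZ : ∀ (N : ℕ) [NeZero N] (W : WeierstrassCurve ℚ) (K : Type) [Field K] [NumberField K],
      gross_zagier N W K)
    (hKo : ∀ (N : ℕ) [NeZero N] (W : WeierstrassCurve ℚ) (K : Type) [Field K] [NumberField K],
      kolyvagin N W K)
    (hB : ∀ (N : ℕ) [NeZero N] (W : WeierstrassCurve ℚ) (K : Type) [Field K] [NumberField K],
      Kolyvagin1990_padicValNat_card_sha_le N W K)
    (hSk : Skinner2016.thmC_padicValRat_bsd_rank_zero) (hWu : sha_dvd_analyticSha)
    (hGZK : rank_eq_analyticRank_of_analyticRank_le_one) (hmod : hasEntireLFunction_rat)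
    (hnf : exists_isNewformOf) (hHL : HoffsteinLuo1997_exists_twist_L_one_ne_zero)
    (hMaz : mazur_not_dvd_maninConstant_of_odd)
    (hPT : ∀ (K : Type) [Field K] [NumberField K], poitouTate_sum_localTatePairing_eq_zero K)
    (hEP : ∀ (K : Type) [Field K] [NumberField K] (v : HeightOneSpectrum (𝓞 K)),
      localEulerPoincareCharacteristic (v.adicCompletion K))
    (hLL : Literature.NumberTheory.Automorphic.diamond1995_refinedSerre)
    (hsst : Semistable W) (hX : ClassX11b W 3) (hA : P2OpenInputOnTreeOddAt W 3)
    (hUα : W.HasSplitMultiplicativeReductionAtPrime 3 → 3 ∣ padicValInt 3 W.minimalDiscriminantInt →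
      Typed.MissingUpperBoundAt W 3)
    (hUβ : ∀ (ℓ : ℕ) [Fact ℓ.Prime], ℓ ≠ 3 → W.HasSplitMultiplicativeReductionAtPrime ℓ →
      3 ∣ padicValInt ℓ W.minimalDiscriminantInt → Typed.MissingUpperBoundAt W 3) :
    BSDp W 3 :=
  bsdp_three_of_classX11b_of_ram_of_openInput_tamagawaLocal W hGZ hKo hB hSk hWu hGZK hmod hnf hHL
    hMaz hPT hEP hX (ram_three_of_semistable_of_irr hnf hLL W hsst hX.2.2.2) hA hUα hUβ
    (fun _ hk hc => absurd ⟨_, hk, hc⟩ (not_exists_typeIV_of_semistable W hsst))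

end ClassLevel

/-! ### §4 The whole-class `p = 3` record with the Tamagawa binder LOCALISED (asks no more than (T2′)@3) -/

/-- **The localised binders ask for no more than multr1-p2's (T2′)@3**: a supplier of
`Typed.MissingUpperBoundAt W 3` on `ClassX11b W 3 ∧ Surj ∧ ¬(Ram ∧ 3 ∤ ∏c)` (the binder `hU` of
`P2.bsdp_three_of_onTree`) supplies each of (T2α)@3, (T2β)@3, (T2γ)@3 and the `¬Ram` binder (each
local shape forces `3 ∣ ∏c_ℓ`: `dvd_tamagawaProduct_of_split_of_dvd`, `dvd_tamagawaProduct_iff_exists_place`).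
[folklore] -/
theorem localBinders_of_typedUpperThree [Fact (Nat.Prime 3)]
    (hU : ∀ (W : WeierstrassCurve ℚ) [W.IsElliptic] [W.IsGloballyMinimal],
      ClassX11b W 3 → Surj W 3 → ¬ (Ram W 3 ∧ ¬ 3 ∣ W.tamagawaProduct) →
        Typed.MissingUpperBoundAt W 3) :
    (∀ (W : WeierstrassCurve ℚ) [W.IsElliptic] [W.IsGloballyMinimal],
        ClassX11b W 3 → Ram W 3 → W.HasSplitMultiplicativeReductionAtPrime 3 →
          3 ∣ padicValInt 3 W.minimalDiscriminantInt → Typed.MissingUpperBoundAt W 3) ∧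
      (∀ (W : WeierstrassCurve ℚ) [W.IsElliptic] [W.IsGloballyMinimal] (ℓ : ℕ) [Fact ℓ.Prime],
        ClassX11b W 3 → Ram W 3 → ℓ ≠ 3 → W.HasSplitMultiplicativeReductionAtPrime ℓ →
          3 ∣ padicValInt ℓ W.minimalDiscriminantInt → Typed.MissingUpperBoundAt W 3) ∧
      (∀ (W : WeierstrassCurve ℚ) [W.IsElliptic] [W.IsGloballyMinimal] (v : HeightOneSpectrum (𝓞 ℚ)),
        ClassX11b W 3 → Ram W 3 →
          (W.kodairaSymbolAt v = .IV ∨ W.kodairaSymbolAt v = .IVstar) → W.tamagawaNumberAt v = 3 →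
            Typed.MissingUpperBoundAt W 3) ∧
      (∀ (W : WeierstrassCurve ℚ) [W.IsElliptic] [W.IsGloballyMinimal],
        ClassX11b W 3 → Surj W 3 → ¬ Ram W 3 → Typed.MissingUpperBoundAt W 3) := by
  refine ⟨fun W _ _ hX hram hs hd => ?_, fun W _ _ ℓ _ hX hram _ hs hd => ?_,
    fun W _ _ v hX hram _ hc => ?_, fun W _ _ hX hsurj hnr => ?_⟩
  · exact hU W hX (surj_of_irr_of_ram W 3 hX.2.2.2 hram)
      (fun h => h.2 (dvd_tamagawaProduct_of_split_of_dvd W hs hd))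
  · exact hU W hX (surj_of_irr_of_ram W 3 hX.2.2.2 hram)
      (fun h => h.2 (dvd_tamagawaProduct_of_split_of_dvd W hs hd))
  · exact hU W hX (surj_of_irr_of_ram W 3 hX.2.2.2 hram)
      (fun h => h.2 ((dvd_tamagawaProduct_iff_exists_place W Nat.prime_three).mpr ⟨v, by rw [hc]⟩))
  · exact hU W hX hsurj (fun h => hnr h.1)

/-- **X11b at `p = 3`, WHOLE CLASS, with the Tamagawa binder localised.** `∀ E` with `(E,3) ∈` X11b
`→ BSD(E,3)` from the twelve published named facts of route p2, THE open input
`P2OpenInputOnTreeOddAt W 3` [NO source at `p = 3`, not even announced: Howard 2007 excludes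
`p ∣ 6N`, Castella 2018/2020, Skinner–Zhang 2014, Fouquet–Wan 2021 all exclude `p = 3`], the
Euler-system half
`Typed.MissingUpperBoundAt W 3` asked SEPARATELY on the three local shapes of the (ram) ∧ `3 ∣ ∏c`
atom — (T2α)@3 split-at-`3` peu ramifié, (T2β)@3 unramified split multiplicative `ℓ ≠ 3`,
(T2γ)@3 additive Kodaira `IV`/`IV*` with `c = 3` — and on the `¬Ram` atom, and the corner input
(T4″)@3. This is multr1-p2's `P2.bsdp_three_of_onTree` (p244493/`BDPRouteOpenInputOdd`) with its
binder (T2′)@3 split along `tamagawa_atom_shape_three`; the split binders ask no more than (T2′)@3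
(`localBinders_of_typedUpperThree`). CONDITIONAL; nothing booked; labels UNCHANGED (X11 ∧ `r = 1`
at `p = 3` CONSTRUCTION-SHAPED, RESIDUAL-MAP §I O2 OPEN).
[cite: JetchevSkinnerWan2017, §7.4.1–7.4.3 (pp. 30–31), Prop. 3.2.1]
[cite: Castella2018, Thm. 2.3 (p. 5), (3.2.1), Thm. 3.2 (p. 9)] [cite: Castella2018Erratum, (2.4) (p. 1)]
[cite: Skinner2016PacificMC, Thm. C (§1) and footnote 1] [cite: McCallumLMS1991, §1 Theorem (Kolyvagin), p. 296]
[cite: Wuthrich2014, Prop. 21 (p. 400)] [cite: MilneADT2006, Ch. I, Thm. 4.10(b) and Thm. 2.8] [cite: Miller2011LMS, Def. 1.1]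
[cite: SilvermanATAEC1994, IV.9.4 Steps 2, 5, 8 and Table 4.1 (PDF pp. 344–346)] -/
theorem bsdp_three_of_classX11b_of_onTreeInputs_tamagawaLocal [Fact (Nat.Prime 3)]
    (hGZ : ∀ (N : ℕ) [NeZero N] (W : WeierstrassCurve ℚ) (K : Type) [Field K] [NumberField K],
      gross_zagier N W K)
    (hKo : ∀ (N : ℕ) [NeZero N] (W : WeierstrassCurve ℚ) (K : Type) [Field K] [NumberField K],
      kolyvagin N W K)
    (hB : ∀ (N : ℕ) [NeZero N] (W : WeierstrassCurve ℚ) (K : Type) [Field K] [NumberField K],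
      Kolyvagin1990_padicValNat_card_sha_le N W K)
    (hSk : Skinner2016.thmC_padicValRat_bsd_rank_zero) (hWu : sha_dvd_analyticSha)
    (hGZK : rank_eq_analyticRank_of_analyticRank_le_one) (hmod : hasEntireLFunction_rat)
    (hnf : exists_isNewformOf) (hHL : HoffsteinLuo1997_exists_twist_L_one_ne_zero)
    (hMaz : mazur_not_dvd_maninConstant_of_odd)
    (hPT : ∀ (K : Type) [Field K] [NumberField K], poitouTate_sum_localTatePairing_eq_zero K)
    (hEP : ∀ (K : Type) [Field K] [NumberField K] (v : HeightOneSpectrum (𝓞 K)),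
      localEulerPoincareCharacteristic (v.adicCompletion K))
    -- (T1ᵗ-IMC, odd) THE open input at `p = 3` — no source
    (hA : ∀ (W : WeierstrassCurve ℚ) [W.IsElliptic] [W.IsGloballyMinimal], P2OpenInputOnTreeOddAt W 3)
    -- (T2α)@3
    (hUα : ∀ (W : WeierstrassCurve ℚ) [W.IsElliptic] [W.IsGloballyMinimal],
      ClassX11b W 3 → Ram W 3 → W.HasSplitMultiplicativeReductionAtPrime 3 →
        3 ∣ padicValInt 3 W.minimalDiscriminantInt → Typed.MissingUpperBoundAt W 3)
    -- (T2β)@3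
    (hUβ : ∀ (W : WeierstrassCurve ℚ) [W.IsElliptic] [W.IsGloballyMinimal] (ℓ : ℕ) [Fact ℓ.Prime],
      ClassX11b W 3 → Ram W 3 → ℓ ≠ 3 → W.HasSplitMultiplicativeReductionAtPrime ℓ →
        3 ∣ padicValInt ℓ W.minimalDiscriminantInt → Typed.MissingUpperBoundAt W 3)
    -- (T2γ)@3 — the shape with no large-prime analogue
    (hUγ : ∀ (W : WeierstrassCurve ℚ) [W.IsElliptic] [W.IsGloballyMinimal]
      (v : HeightOneSpectrum (𝓞 ℚ)), ClassX11b W 3 → Ram W 3 →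
        (W.kodairaSymbolAt v = .IV ∨ W.kodairaSymbolAt v = .IVstar) → W.tamagawaNumberAt v = 3 →
          Typed.MissingUpperBoundAt W 3)
    -- the `¬Ram` atom (all non-semistable at 3; RESIDUAL-MAP §H ⟦rmap-3 g4⟧)
    (hU₀ : ∀ (W : WeierstrassCurve ℚ) [W.IsElliptic] [W.IsGloballyMinimal],
      ClassX11b W 3 → Surj W 3 → ¬ Ram W 3 → Typed.MissingUpperBoundAt W 3)
    -- (T4″)@3 the non-surjective corner (3Ns/3Nn)
    (hC : ∀ (W : WeierstrassCurve ℚ) [W.IsElliptic] [W.IsGloballyMinimal],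
      ClassX11b W 3 → ¬ Surj W 3 → 3 ∣ padicValInt 3 W.minimalDiscriminantInt → ¬ Ram W 3 →
        Typed.MissingPPartAt W 3)
    (W : WeierstrassCurve ℚ) [W.IsElliptic] [W.IsGloballyMinimal] (hX : ClassX11b W 3) :
    BSDp W 3 := by
  refine P2.bsdp_three_of_onTree hGZ hKo hB hSk hWu hGZK hmod hnf hHL hMaz hPT hEP hA ?_ hC W hX
  intro W _ _ hX hsurj hnot
  by_cases hram : Ram W 3
  · have ht : 3 ∣ W.tamagawaProduct := by
      by_contra h
      exact hnot ⟨hram, h⟩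
    rcases tamagawa_atom_shape_three W hX ht with ⟨hs, hd⟩ | ⟨ℓ, hℓ, hne, hs, hd⟩ | ⟨v, hk, hc⟩
    · exact hUα W hX hram hs hd
    · exact hUβ W ℓ hX hram hne hs hd
    · exact hUγ W v hX hram hk hc
  · exact hU₀ W hX hsurj hram

end Summit.BirchSwinnertonDyer.Rank1Residual.X11b.Three

end
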